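import Literature.MathematicalPhysics.QuantumFieldTheory.Balaban1983to89.B9PerturbationMajorantAlgebra
import Literature.MathematicalPhysics.QuantumFieldTheory.Balaban1983to89.B9Thm312WholeL2

/-!
# `Balaban1983to89.B9Thm313WholeDvFromDds` — [B9] Theorems 3.12–3.13 (pp. 420–426): THE D_U-RIGHT COMPOSITES OF THE SECT.-D LETTERS OF ROWS
# 20–21 (G₀D_U, ∇_UG₀D_U, ∇_{U,ν}G₀D_U; sup and block-L² forms) ARE THEOREM 3.3 FOR G₀'s DIRECTIONAL ∇*-ENTRIES COMPOSED WITH ONE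
# KINEMATIC DECOMPOSITION D_U = Σ_μ ∇*_{U,μ}∘J_μ — five displayed letter fields become theorems of rows 19's derived material

T. Bałaban, *Propagators for lattice gauge theories in a background field*, Commun. Math. Phys. **99** (1985) 389–434
[`Balaban1985BackgroundPropagators`, "B9"]; [4] = T. Bałaban, *Propagators and renormalization transformations for lattice gauge
theories. II*, Commun. Math. Phys. **96** (1984) 223–250 [`Balaban1984PropagatorsII`].

statement-level skeleton of published theorems with citation tags; proofs where landed; nothing here is a claim about the Yang–Mills
mass gap

THE PRINTED LOCUS (held text `paper:balaban1985-cmp99-background-propagators`).  (3.3) p. 390: *"(D_Uλ)(b) = η⁻¹(U(b)λ(b₊) − λ(b₋))"*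
(the covariant gradient of a scalar λ, a vector function whose μ-component is the covariant derivative ∇_{U,μ}λ); (3.8) p. 392 (∇*_{U,μ}, the
covariant derivative along the reversed bond, componentwise on vector functions); Theorem 3.3 p. 399 with (3.42) p. 397: *"|(G(U)∇*_UJ)(x)| ≦
B₀Lʲη·e^{−δ₀d(y,y′)}|J|"*, (3.46) p. 398 (the block-L² lines incl. ∇_UG∇*_U); p. 398: *"we may always replace ∇_U by ∇*_U … in arbitrary place"*;
(3.133) p. 422 and (3.152)–(3.153) p. 426 (the operators G₀D_U, ∇_UG₀D_U of the expansions of H, H₁, 𝔊); [4] (2.52)–(2.56), Lemma 2.1 (2.60)–(2.61).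

THE POINT.  The rows-20–21 leaves display, among the Sect.-D letters, the composites of G₀ = G(U) with the covariant GRADIENT D_U of the gauge
sector: `Letters313Z.gD1 ∕ gD2` (sup classes; `gD2` is moreover the input `hgD12` of the G₀-layer `N06G0LayerFromThm310E.g0_layer_of_thm310_coreB`)
and `Letters313L2PZ.gDv ∕ dGDv`, `Letters313L2MZ.dGDvd` (block-L²).  At the letters, D_U is a finite sum of the DIRECTION letters ∇*_{U,μ} of the bond
sector after a kinematic embedding: (D_Uλ)_μ = ∇_{U,μ}λ = −∇*_{U,μ}(R(U_μ(·))λ(· + e_μ)), i.e. D_U = Σ_μ ∇*_{U,μ}∘J_μ with J_μ the operator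
placing one transported neighbour value into the μ-component (a block-local letter of norm ≦ the transporter's; at def-Y's pins
`DvcoKH = Σ_μ (𝔡A x).Dsd U μ ∘ₗ JcoKH μ U`, slice-preserving in the coordinate model).  Hence
  G₀D_U = Σ_μ (G₀∇*_{U,μ})∘J_μ,  ∇_{U,ν}G₀D_U = Σ_μ (∇_{U,ν}G₀∇*_{U,μ})∘J_μ,  ∇_UG₀D_U = Σ_{ν,μ} Π_ν∘(∇_{U,ν}G₀∇*_{U,μ})∘J_μ
(Π_ν = the direction-slice projector writing the slice-diagonal ∇_U of the letters as Σ_ν Π_ν∘∇_{U,ν}), and the directional right entries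
G₀∇*_{U,μ} (sup: `Thm33G0DirR.e2d`; block-L²: `Thm33G0L2M.l2d`) and ∇_{U,ν}G₀∇*_{U,μ} (block-L²: `Thm33G0L2M.l4m`) ARE rows 19's DERIVED material
(`B9Thm312WholeFromThm310.thm33G0DirR_of_conv3107`, `B9Thm312WholeFromThm310L2.thm33G0L2M_of_conv3107`).  THIS FILE types the compositions ([4]
(2.52)–(2.56), Lemma 2.1's row sum spent on the kinematic letter so that no rate is lost on G₀):
* §0 finite sums of majorants ∕ block bounds over an index set; the rewriting `A∘D_U = Σ_μ (A∘∇*_{U,μ})∘J_μ`;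
* §1 the sup letters: `gD1_of_e2d` (G₀D_U : 𝔠_W⁽⁰⁾ → 𝔠⁽¹⁾), `hasMaj_shift_one` + `gD2_of_e2d` (G₀D_U : 𝔠_W⁽¹⁾ → 𝔠⁽²⁾, one p. 398 transfer);
* §2 the block-L² letters: `gDv_l2_of_l2d` (G₀D_U), `dGDvd_l2_of_l4m` (∇_{U,ν}G₀D_U), `dGDv_l2_of_l4m` (∇_UG₀D_U, with the slice projectors).

NOT HERE (located).  `Letters313L2PZ.ddGDv` (needs the third-order block-L² line ∇_U∇_UG₀∇*_U, not among `Thm33G0L2P ∕ L2M`'s lines); the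
HÖLDER-source members `Letters313DZ.dgDH`, `Letters313DMZ.dgDHd`, `Letters313HZ.pYDH`, `Thm33G0DivR.h44DsDv` (J_μ between Hölder classes costs a
transport commutator — curvature, a genuine Reg335-small estimate); the probe-target `Letters313HZ.pXDv` (needs Φ^X_β∘G₀∘∇*_{U,μ} at the direction
letter).

HONEST SCOPE.  Kernel bookkeeping over landed modules: five displayed ANALYTIC letter fields of rows 20–21 become theorems of rows 19's derived
Theorem-3.3-for-G₀ schemas and of TWO KINEMATIC letters (`hDv`+`hJ`∕`hJL2`: D_U = Σ_μ ∇*_{U,μ}∘J_μ with the block-local majorants of J_μ; `hD`+`hPr`: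
∇_U = Σ_ν Π_ν∘∇_{U,ν}) — HYPOTHESES here, dischargeable at def-Y's `DvcoKH ∕ DcoK` by an instance file, NOT asserted.  Nothing of print's estimates is
asserted.  COUNT-NEUTRAL; N06 NOT discharged; one finite lattice at a time; nothing continuum, nothing about the mass gap.  Cell `pub-ymgap` (HUMAN
RULING D-0062), Track A node N06 [B9], N06-ASSIGNMENT v1 rows 20–21 (bundle F7), seat `pub-ymgap-dag-n06-l` (g17), 2026-08-28.
-/

namespace Literature.MathematicalPhysics.QuantumFieldTheory.Balaban1983to89.B9Thm313WholeDvFromDds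

open Literature.MathematicalPhysics.QuantumFieldTheory.Balaban1983to89
open Finset B6RandomWalk B6RandomWalkHom B9Thm34Ext B11SectG B9SectDSup B9SectDL2Decay B9Thm37Glue B9Thm312Whole
open B9Thm312WholeClasses B9RWSums343to347Whole B9RWSums346Schur B9PerturbationMajorantAlgebra

noncomputable section

variable {g : B9.Geometry} {X Y W P : Type} [Fintype X] [Fintype Y] [Fintype W] [Fintype P] [Fintype g.Site]
variable {R₀ : ℝ} {H₀ : Prop}

/-! ## §0 Finite sums of majorants and block bounds; the kinematic rewriting -/

omit [Fintype X] [Fintype Y] [Fintype W] [Fintype P] in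
/-- *"A summation preserves it also"* ([4] p. 232), finite-index form: majorants of a finite family add.
[cite: Balaban1984PropagatorsII, (2.52) p.232 (bookkeeping)] -/
theorem hasMaj_fsum {ι F₁ F₂ : Type} [AddCommGroup F₁] [Module ℝ F₁] [AddCommGroup F₂] [Module ℝ F₂]
    {b₁ : BlockNorm (toB6 g R₀ H₀) F₁} {b₂ : BlockNorm (toB6 g R₀ H₀) F₂} (s : Finset ι) (T : ι → F₁ →ₗ[ℝ] F₂)
    (K : ι → g.Site → g.Site → ℝ) (h : ∀ i ∈ s, HasMaj b₁ b₂ (T i) (K i)) :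
    HasMaj b₁ b₂ (∑ i ∈ s, T i) (fun a b => ∑ i ∈ s, K i a b) := by
  classical
  induction s using Finset.induction_on with
  | empty => simpa using hasMaj_zero b₁ b₂
  | insert j s hj ih =>
      have h' := (h j (Finset.mem_insert_self j s)).add (ih fun i hi => h i (Finset.mem_insert_of_mem hi))
      simpa only [Finset.sum_insert hj] using h'

omit [Fintype X] [Fintype Y] [Fintype W] [Fintype P] in
/-- Finite sums of majorants with ONE common kernel: the kernel times the number of summands. [cite: Balaban1984PropagatorsII, (2.52) p.232 (bookkeeping)] -/
theorem hasMaj_fsum_const {ι F₁ F₂ : Type} [AddCommGroup F₁] [Module ℝ F₁] [AddCommGroup F₂] [Module ℝ F₂]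
    {b₁ : BlockNorm (toB6 g R₀ H₀) F₁} {b₂ : BlockNorm (toB6 g R₀ H₀) F₂} (s : Finset ι) (T : ι → F₁ →ₗ[ℝ] F₂)
    (K : g.Site → g.Site → ℝ) (h : ∀ i ∈ s, HasMaj b₁ b₂ (T i) K) :
    HasMaj b₁ b₂ (∑ i ∈ s, T i) (fun a b => (s.card : ℝ) * K a b) :=
  (hasMaj_fsum s T (fun _ => K) h).mono fun a b => by rw [Finset.sum_const, nsmul_eq_mul]

omit [Fintype Y] [Fintype P] in
/-- Finite sums of block-L² bounds ((3.46)-lines add). [cite: Balaban1985BackgroundPropagators, (3.46) p.398 (bookkeeping)] -/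
theorem blockBd_fsum {ι : Type} {blk₁ : W → g.Site} {blk₂ : X → g.Site} (s : Finset ι) (T : ι → (W → ℝ) →ₗ[ℝ] (X → ℝ))
    (N : ι → g.Site → g.Site → ℝ) (h : ∀ i ∈ s, BlockBd (g := toB6 g R₀ H₀) blk₁ blk₂ (T i) (N i)) :
    BlockBd (g := toB6 g R₀ H₀) blk₁ blk₂ (∑ i ∈ s, T i) (fun y y' => ∑ i ∈ s, N i y y') := by
  rw [blockBd_iff_hasMaj]
  exact hasMaj_fsum s T N fun i hi => (blockBd_iff_hasMaj _ _ _ _).mp (h i hi)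

/-- Post-composition distributes over finite sums of linear maps (private plumbing). [folklore] -/
private theorem comp_fsum {ι M N K : Type} [AddCommGroup M] [Module ℝ M] [AddCommGroup N] [Module ℝ N] [AddCommGroup K] [Module ℝ K]
    (s : Finset ι) (A : N →ₗ[ℝ] K) (T : ι → M →ₗ[ℝ] N) : A ∘ₗ (∑ i ∈ s, T i) = ∑ i ∈ s, A ∘ₗ T i := by
  apply LinearMap.ext
  intro f
  simp only [LinearMap.comp_apply, LinearMap.sum_apply, map_sum]

/-- Pre-composition distributes over finite sums of linear maps (private plumbing). [folklore] -/
private theorem fsum_comp {ι M N K : Type} [AddCommGroup M] [Module ℝ M] [AddCommGroup N] [Module ℝ N] [AddCommGroup K] [Module ℝ K]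
    (s : Finset ι) (A : M →ₗ[ℝ] N) (T : ι → N →ₗ[ℝ] K) : (∑ i ∈ s, T i) ∘ₗ A = ∑ i ∈ s, T i ∘ₗ A := by
  apply LinearMap.ext
  intro f
  simp only [LinearMap.comp_apply, LinearMap.sum_apply]

omit [Fintype X] [Fintype Y] [Fintype W] in
/-- ★ **THE KINEMATIC REWRITING**: D_U = Σ_μ ∇*_{U,μ}∘J_μ ⇒ A∘D_U = Σ_μ (A∘∇*_{U,μ})∘J_μ for every left factor A (A = G₀, ∇_{U,ν}G₀, ∇_UG₀).
[cite: Balaban1985BackgroundPropagators, (3.3) p.390 + (3.8) p.392 (D_U componentwise = the ∇_{U,μ}; ∇_{U,μ} = −∇*_{U,μ}∘(transported shift))] -/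
theorem comp_dv_eq_fsum {V : Type} {Dds : P → Module.End ℝ (X → ℝ)} {J : P → (W → ℝ) →ₗ[ℝ] (X → ℝ)} {Dv : (W → ℝ) →ₗ[ℝ] (X → ℝ)}
    (hDv : Dv = ∑ μ, Dds μ ∘ₗ J μ) (A : (X → ℝ) →ₗ[ℝ] (V → ℝ)) : A ∘ₗ Dv = ∑ μ, (A ∘ₗ Dds μ) ∘ₗ J μ := by
  rw [hDv, comp_fsum]
  rfl

/-! ## §1 The sup letters: G₀D_U : 𝔠_W⁽⁰⁾ → 𝔠⁽¹⁾ and 𝔠_W⁽¹⁾ → 𝔠⁽²⁾ -/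

omit [Fintype Y] in
/-- ★★ **G₀D_U : 𝔠_W⁽⁰⁾ → 𝔠⁽¹⁾ (`Letters313Z.gD1`) FROM (3.42)₃ FOR G₀ AT THE DIRECTION LETTERS AND THE KINEMATIC LETTER J**: each G₀∇*_{U,μ} : 𝔠⁽⁰⁾ → 𝔠⁽¹⁾
(B₀Lʲη·e^{−δ₀d}, `Thm33G0DirR.e2d`) after J_μ : 𝔠_W⁽⁰⁾ → 𝔠⁽⁰⁾ (C_J·e^{−δ_Jd}) has B₀C_Jc·e^{−δ₃d} for δ₃ ≦ δ₀, δ₃ + σ ≦ δ_J (row sum spent on J_μ;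
[4] (2.54)+(2.61)); summing the |P| directions, any B₃ ≧ |P|·B₀C_Jc serves.
[cite: Balaban1985BackgroundPropagators, Thm 3.3 (3.42) p.397 + (3.133) p.422 + (3.3) p.390; Balaban1984PropagatorsII, (2.52)–(2.56) pp.232–233 + Lemma 2.1 (2.61) p.234] -/
theorem gD1_of_e2d (hG : GeoOK g) {σ c : ℝ} (hrow : RowSum (toB6 g R₀ H₀) σ c)
    {blkW : W → g.Site} {blk : X → g.Site} {G0 : Module.End ℝ (X → ℝ)} {Dds : P → Module.End ℝ (X → ℝ)}
    {J : P → (W → ℝ) →ₗ[ℝ] (X → ℝ)} {Dv : (W → ℝ) →ₗ[ℝ] (X → ℝ)} {B₀ δ₀ CJ δJ B₃ δ₃ : ℝ}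
    (hB₀ : 0 ≤ B₀) (hCJ : 0 ≤ CJ) (hδ₃ : 0 ≤ δ₃) (hδ₃0 : δ₃ ≤ δ₀) (hδ₃J : δ₃ + σ ≤ δJ)
    (hB₃ : (Fintype.card P : ℝ) * (B₀ * CJ * c) ≤ B₃)
    (hDv : Dv = ∑ μ, Dds μ ∘ₗ J μ)
    (he2d : ∀ μ, HasMajorantHom (g := toB6 g R₀ H₀) blk blk (G0 ∘ₗ Dds μ)
      (fun (a b : g.Site) => B₀ * g.len a * Real.exp (-(δ₀ * g.dist a b))))
    (hJ : ∀ μ, HasMaj (cNorm R₀ H₀ blkW hG.lenle 0) (cNorm R₀ H₀ blk hG.lenle 0) (J μ)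
      (fun a b => CJ * Real.exp (-(δJ * g.dist a b)))) :
    HasMaj (cNorm R₀ H₀ blkW hG.lenle 0) (cNorm R₀ H₀ blk hG.lenle 1) (G0 ∘ₗ Dv)
      (fun a b => B₃ * Real.exp (-(δ₃ * g.dist a b))) := by
  have htri : Triangle254 (toB6 g R₀ H₀) := fun a b c => hG.tri a b c
  have hsym : DistSymm (toB6 g R₀ H₀) := fun a b => hG.symm a b
  -- each G₀∇*_{U,μ} : 𝔠⁽⁰⁾ → 𝔠⁽¹⁾
  have h1 : ∀ μ, HasMaj (cNorm R₀ H₀ blk hG.lenle 0) (cNorm R₀ H₀ blk hG.lenle 1) (G0 ∘ₗ Dds μ)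
      (fun a b => B₀ * Real.exp (-(δ₀ * g.dist a b))) := by
    intro μ
    have h := hasMaj_cls_of_hom hG 1 hB₀ (hasMajorantHom_mono (g := toB6 g R₀ H₀) blk blk (he2d μ)
      fun a b => le_of_eq (by rw [Real.rpow_one]))
    have h' : HasMaj (cNormR R₀ H₀ blk hG.lenle (-((0 : ℕ) : ℝ))) (cNormR R₀ H₀ blk hG.lenle (-((1 : ℕ) : ℝ))) (G0 ∘ₗ Dds μ)
        (fun a b => B₀ * Real.exp (-(δ₀ * g.dist a b))) := by
      simpa only [Nat.cast_zero, neg_zero, Nat.cast_one] using h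
    exact hasMaj_ofR hG h'
  -- after J_μ, the row sum spent on J_μ
  have h2 : ∀ μ ∈ (Finset.univ : Finset P), HasMaj (cNorm R₀ H₀ blkW hG.lenle 0) (cNorm R₀ H₀ blk hG.lenle 1)
      ((G0 ∘ₗ Dds μ) ∘ₗ J μ) (fun a b => B₀ * CJ * c * Real.exp (-(δ₃ * g.dist a b))) := by
    intro μ _
    refine (hasMaj_comp_exp_mirror hsym htri hG.dnn hrow hB₀ hCJ hδ₃ hδ₃0 hδ₃J (h1 μ) (hJ μ)).mono fun a b => le_of_eq ?_
    simp only [cNorm_κ, toB6_dist]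
    ring
  rw [comp_dv_eq_fsum hDv G0]
  refine (hasMaj_fsum_const _ _ _ h2).mono fun a b => ?_
  rw [Finset.card_univ]
  calc (Fintype.card P : ℝ) * (B₀ * CJ * c * Real.exp (-(δ₃ * g.dist a b)))
      = (Fintype.card P : ℝ) * (B₀ * CJ * c) * Real.exp (-(δ₃ * g.dist a b)) := by ring
    _ ≤ B₃ * Real.exp (-(δ₃ * g.dist a b)) := mul_le_mul_of_nonneg_right hB₃ (Real.exp_nonneg _)

omit [Fintype Y] [Fintype P] in
/-- **p. 398's TRANSFER BY ONE POWER**: a majorant C·e^{−rd} from 𝔠_W⁽⁰⁾ into 𝔠⁽¹⁾ is the majorant C·L₀·e^{−(r−αδ)d} from 𝔠_W⁽¹⁾ into 𝔠⁽²⁾ under the member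
facts ([4] (2.60): the ratio L^{j′}η∕Lʲη costs L·e^{αδd}; `B9PerturbationMajorantAlgebra.hasMaj_shift` at γ = −1).
[cite: Balaban1985BackgroundPropagators, p.398 (remark after (3.47)); Balaban1984PropagatorsII, Lemma 2.1 (2.60) p.234] -/
theorem hasMaj_shift_one (hG : GeoOK g) {dF : ℕ} {δ α L₀ : ℝ} (hF : Facts347 g R₀ H₀ dF δ α L₀) {blkW : W → g.Site} {blk : X → g.Site}
    {T : (W → ℝ) →ₗ[ℝ] (X → ℝ)} {C r : ℝ} (hC : 0 ≤ C)
    (h : HasMaj (cNorm R₀ H₀ blkW hG.lenle 0) (cNorm R₀ H₀ blk hG.lenle 1) T (fun a b => C * Real.exp (-(r * g.dist a b)))) :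
    HasMaj (cNorm R₀ H₀ blkW hG.lenle 1) (cNorm R₀ H₀ blk hG.lenle 2) T (fun a b => C * L₀ * Real.exp (-((r - α * δ) * g.dist a b))) := by
  have h0 := hasMaj_shift hG hF (-1) (by norm_num) hC (hasMaj_toR hG h)
  have e1 : (-((0 : ℕ) : ℝ) + -1) = -((1 : ℕ) : ℝ) := by norm_num
  have e2 : (-((1 : ℕ) : ℝ) + -1) = -((2 : ℕ) : ℝ) := by norm_num
  rw [e1, e2, rpow_abs_eq_pow g.L (-1) 1 (by norm_num), pow_one] at h0
  refine (hasMaj_ofR hG h0).mono fun a b => ?_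
  have hE : 0 ≤ Real.exp (-((r - α * δ) * g.dist a b)) := Real.exp_nonneg _
  calc C * g.L * Real.exp (-((r - α * δ) * g.dist a b)) ≤ C * L₀ * Real.exp (-((r - α * δ) * g.dist a b)) :=
        mul_le_mul_of_nonneg_right (mul_le_mul_of_nonneg_left hF.L_le hC) hE
    _ = _ := rfl

omit [Fintype Y] in
/-- ★★ **G₀D_U : 𝔠_W⁽¹⁾ → 𝔠⁽²⁾ (`Letters313Z.gD2` = THE INPUT `hgD12` OF THE G₀-LAYER)**: `gD1_of_e2d` followed by the one-power transfer of p. 398 —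
constant |P|·B₀C_Jc·L₀, rate δ₃ − αδ; any B₃′ above and any δ₃′ below serve.
[cite: Balaban1985BackgroundPropagators, Thm 3.3 (3.42) p.397 + p.398 (remark after (3.47)) + (3.133) p.422; Balaban1984PropagatorsII, (2.52)–(2.56) pp.232–233 + Lemma 2.1 (2.60)–(2.61) p.234] -/
theorem gD2_of_e2d (hG : GeoOK g) {σ c : ℝ} (hrow : RowSum (toB6 g R₀ H₀) σ c) {dF : ℕ} {δ α L₀ : ℝ} (hF : Facts347 g R₀ H₀ dF δ α L₀)
    {blkW : W → g.Site} {blk : X → g.Site} {G0 : Module.End ℝ (X → ℝ)} {Dds : P → Module.End ℝ (X → ℝ)}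
    {J : P → (W → ℝ) →ₗ[ℝ] (X → ℝ)} {Dv : (W → ℝ) →ₗ[ℝ] (X → ℝ)} {B₀ δ₀ CJ δJ δ₃ B₃' δ₃' : ℝ}
    (hB₀ : 0 ≤ B₀) (hCJ : 0 ≤ CJ) (hc : 0 ≤ c) (hδ₃ : 0 ≤ δ₃) (hδ₃0 : δ₃ ≤ δ₀) (hδ₃J : δ₃ + σ ≤ δJ)
    (hB₃' : (Fintype.card P : ℝ) * (B₀ * CJ * c) * L₀ ≤ B₃') (hδ₃' : δ₃' ≤ δ₃ - α * δ)
    (hDv : Dv = ∑ μ, Dds μ ∘ₗ J μ)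
    (he2d : ∀ μ, HasMajorantHom (g := toB6 g R₀ H₀) blk blk (G0 ∘ₗ Dds μ)
      (fun (a b : g.Site) => B₀ * g.len a * Real.exp (-(δ₀ * g.dist a b))))
    (hJ : ∀ μ, HasMaj (cNorm R₀ H₀ blkW hG.lenle 0) (cNorm R₀ H₀ blk hG.lenle 0) (J μ)
      (fun a b => CJ * Real.exp (-(δJ * g.dist a b)))) :
    HasMaj (cNorm R₀ H₀ blkW hG.lenle 1) (cNorm R₀ H₀ blk hG.lenle 2) (G0 ∘ₗ Dv)
      (fun a b => B₃' * Real.exp (-(δ₃' * g.dist a b))) := by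
  have hK : 0 ≤ (Fintype.card P : ℝ) * (B₀ * CJ * c) :=
    mul_nonneg (Nat.cast_nonneg _) (mul_nonneg (mul_nonneg hB₀ hCJ) hc)
  have h1 := gD1_of_e2d hG hrow hB₀ hCJ hδ₃ hδ₃0 hδ₃J le_rfl hDv he2d hJ
  have h2 := hasMaj_shift_one hG hF hK h1
  have hL₀ : 0 ≤ L₀ := le_trans (le_trans zero_le_one hF.one_le_L) hF.L_le
  exact hasMaj_weaken hG (mul_nonneg hK hL₀) hB₃' hδ₃' h2

/-! ## §2 The block-L² letters: G₀D_U, ∇_{U,ν}G₀D_U, ∇_UG₀D_U -/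

omit [Fintype Y] in
/-- ★★ **G₀D_U IN BLOCK L² (`Letters313L2PZ.gDv`)**: ‖1_{Δ(y)}G₀∇*_{U,μ}A‖₂ ≦ B₂Lʲη·e^{−δ₁d}‖A‖₂ (`Thm33G0L2M.l2d`, the (3.46) line of G∇*) after the block
bound C_J·e^{−δ_Jd} of J_μ gives, summed over μ, ‖1_{Δ(y)}G₀D_Uλ‖₂ ≦ B₄Lʲη·e^{−ρd(y,y′)}‖λ‖₂ for supp λ ⊂ Δ(y′), any B₄ ≧ |P|·B₂C_Jc, 0 ≦ ρ ≦ δ₁,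
ρ + σ ≦ δ_J. [cite: Balaban1985BackgroundPropagators, (3.46) p.398 + (3.153) p.426 + (3.3) p.390; Balaban1984PropagatorsII, (2.52)–(2.56) pp.232–233 + Lemma 2.1 (2.61) p.234] -/
theorem gDv_l2_of_l2d (hG : GeoOK g) {σ c : ℝ} (hrow : RowSum (toB6 g R₀ H₀) σ c)
    {blkW : W → g.Site} {blk : X → g.Site} {G0 : Module.End ℝ (X → ℝ)} {Dds : P → Module.End ℝ (X → ℝ)}
    {J : P → (W → ℝ) →ₗ[ℝ] (X → ℝ)} {Dv : (W → ℝ) →ₗ[ℝ] (X → ℝ)} {B₂ δ₁ CJ δJ B₄ ρ : ℝ}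
    (hB₂ : 0 ≤ B₂) (hCJ : 0 ≤ CJ) (hρ : 0 ≤ ρ) (hρ₁ : ρ ≤ δ₁) (hρJ : ρ + σ ≤ δJ)
    (hB₄ : (Fintype.card P : ℝ) * (B₂ * CJ * c) ≤ B₄)
    (hDv : Dv = ∑ μ, Dds μ ∘ₗ J μ)
    (hl2d : ∀ μ, BlockBd (g := toB6 g R₀ H₀) blk blk (G0 ∘ₗ Dds μ)
      (fun (y y' : g.Site) => B₂ * g.len y * Real.exp (-(δ₁ * g.dist y y'))))
    (hJL2 : ∀ μ, BlockBd (g := toB6 g R₀ H₀) blkW blk (J μ) (fun (y y' : g.Site) => CJ * Real.exp (-(δJ * g.dist y y')))) :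
    BlockBd (g := toB6 g R₀ H₀) blkW blk (G0 ∘ₗ Dv) (fun (y y' : g.Site) => B₄ * g.len y * Real.exp (-(ρ * g.dist y y'))) := by
  have htri : Triangle254 (toB6 g R₀ H₀) := fun a b c => hG.tri a b c
  have hsym : DistSymm (toB6 g R₀ H₀) := fun a b => hG.symm a b
  have hli : ∀ y, 0 ≤ (g.len y)⁻¹ := fun y => inv_nonneg.mpr (hG.lenle y)
  have h1 : ∀ y : g.Site, (0 : ℝ) ≤ 1 := fun _ => zero_le_one
  -- G₀∇*_{U,μ} : (block-L², weight 1) → (block-L², weight (Lʲη)⁻¹)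
  have hA : ∀ μ, HasMaj (l2w (toB6 g R₀ H₀) blk (fun _ => 1) h1) (l2w (toB6 g R₀ H₀) blk (fun y => (g.len y)⁻¹) hli) (G0 ∘ₗ Dds μ)
      (fun a b => B₂ * Real.exp (-(δ₁ * g.dist a b))) := fun μ =>
    hasMaj_l2w_of_blockBd (g := toB6 g R₀ H₀) h1 hli (hl2d μ) fun y y' => le_of_eq (by
      show (g.len y)⁻¹ * (B₂ * g.len y * Real.exp (-(δ₁ * g.dist y y'))) = B₂ * Real.exp (-(δ₁ * g.dist y y')) * 1
      have hl0 : g.len y ≠ 0 := (hG.lenpos y).ne'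
      calc (g.len y)⁻¹ * (B₂ * g.len y * Real.exp (-(δ₁ * g.dist y y')))
          = ((g.len y)⁻¹ * g.len y) * (B₂ * Real.exp (-(δ₁ * g.dist y y'))) := by ring
        _ = B₂ * Real.exp (-(δ₁ * g.dist y y')) * 1 := by rw [inv_mul_cancel₀ hl0]; ring)
  -- J_μ : (block-L², weight 1) → (block-L², weight 1)
  have hJ' : ∀ μ, HasMaj (l2w (toB6 g R₀ H₀) blkW (fun _ => 1) h1) (l2w (toB6 g R₀ H₀) blk (fun _ => 1) h1) (J μ)
      (fun a b => CJ * Real.exp (-(δJ * g.dist a b))) := fun μ => (blockBd_iff_hasMaj _ _ _ _).mp (hJL2 μ)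
  have h2 : ∀ μ ∈ (Finset.univ : Finset P), HasMaj (l2w (toB6 g R₀ H₀) blkW (fun _ => 1) h1)
      (l2w (toB6 g R₀ H₀) blk (fun y => (g.len y)⁻¹) hli) ((G0 ∘ₗ Dds μ) ∘ₗ J μ)
      (fun a b => B₂ * CJ * c * Real.exp (-(ρ * g.dist a b))) := by
    intro μ _
    refine (hasMaj_comp_exp_mirror hsym htri hG.dnn hrow hB₂ hCJ hρ hρ₁ hρJ (hA μ) (hJ' μ)).mono fun a b => le_of_eq ?_
    simp only [l2w_κ, toB6_dist]
    ring
  have hsum := hasMaj_fsum_const _ _ _ h2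
  rw [comp_dv_eq_fsum hDv G0]
  refine (blockBd_of_hasMaj_l2w (g := toB6 g R₀ H₀) hsum fun y => inv_pos.mpr (hG.lenpos y)).mono fun y y' => ?_
  show ((Finset.univ : Finset P).card : ℝ) * (B₂ * CJ * c * Real.exp (-(ρ * g.dist y y'))) * 1 / (g.len y)⁻¹ ≤
    B₄ * g.len y * Real.exp (-(ρ * g.dist y y'))
  rw [Finset.card_univ, mul_one, div_inv_eq_mul]
  calc (Fintype.card P : ℝ) * (B₂ * CJ * c * Real.exp (-(ρ * g.dist y y'))) * g.len y
      = (Fintype.card P : ℝ) * (B₂ * CJ * c) * g.len y * Real.exp (-(ρ * g.dist y y')) := by ring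
    _ ≤ B₄ * g.len y * Real.exp (-(ρ * g.dist y y')) :=
        mul_le_mul_of_nonneg_right (mul_le_mul_of_nonneg_right hB₄ (hG.lenle y)) (Real.exp_nonneg _)

omit [Fintype P] in
/-- **A UNIFORM (3.46)-LINE AFTER THE KINEMATIC LETTER, AS A MAJORANT BETWEEN THE UNWEIGHTED BLOCK-L² SPACES**: if every A_μ has the block bound
C_A·e^{−δ₁d} and every J_μ the block bound C_J·e^{−δ_Jd}, then Σ_{μ∈s} A_μ∘J_μ has |s|·C_AC_Jc·e^{−ρd} (0 ≦ ρ ≦ δ₁, ρ + σ ≦ δ_J).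
[cite: Balaban1985BackgroundPropagators, (3.46) p.398; Balaban1984PropagatorsII, (2.52)–(2.56) pp.232–233 + Lemma 2.1 (2.61) p.234] -/
theorem hasMaj_l2_fsum_comp (hG : GeoOK g) {σ c : ℝ} (hrow : RowSum (toB6 g R₀ H₀) σ c) {ι : Type} (s : Finset ι)
    {blkW : W → g.Site} {blk : X → g.Site} {blkY : Y → g.Site} {A : ι → (X → ℝ) →ₗ[ℝ] (Y → ℝ)} {J : ι → (W → ℝ) →ₗ[ℝ] (X → ℝ)}
    {CA δ₁ CJ δJ ρ : ℝ} (hCA : 0 ≤ CA) (hCJ : 0 ≤ CJ) (hρ : 0 ≤ ρ) (hρ₁ : ρ ≤ δ₁) (hρJ : ρ + σ ≤ δJ)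
    (hA : ∀ i ∈ s, BlockBd (g := toB6 g R₀ H₀) blk blkY (A i) (fun (y y' : g.Site) => CA * Real.exp (-(δ₁ * g.dist y y'))))
    (hJL2 : ∀ i ∈ s, BlockBd (g := toB6 g R₀ H₀) blkW blk (J i) (fun (y y' : g.Site) => CJ * Real.exp (-(δJ * g.dist y y')))) :
    HasMaj (l2w (toB6 g R₀ H₀) blkW (fun _ => 1) (fun _ => zero_le_one)) (l2w (toB6 g R₀ H₀) blkY (fun _ => 1) (fun _ => zero_le_one))
      (∑ i ∈ s, A i ∘ₗ J i) (fun a b => (s.card : ℝ) * (CA * CJ * c) * Real.exp (-(ρ * g.dist a b))) := by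
  have htri : Triangle254 (toB6 g R₀ H₀) := fun a b c => hG.tri a b c
  have hsym : DistSymm (toB6 g R₀ H₀) := fun a b => hG.symm a b
  have h2 : ∀ i ∈ s, HasMaj (l2w (toB6 g R₀ H₀) blkW (fun _ => 1) (fun _ => zero_le_one))
      (l2w (toB6 g R₀ H₀) blkY (fun _ => 1) (fun _ => zero_le_one)) (A i ∘ₗ J i)
      (fun a b => CA * CJ * c * Real.exp (-(ρ * g.dist a b))) := by
    intro i hi
    refine (hasMaj_comp_exp_mirror hsym htri hG.dnn hrow hCA hCJ hρ hρ₁ hρJ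
      ((blockBd_iff_hasMaj _ _ _ _).mp (hA i hi)) ((blockBd_iff_hasMaj _ _ _ _).mp (hJL2 i hi))).mono fun a b => le_of_eq ?_
    simp only [l2w_κ, toB6_dist]
    ring
  exact (hasMaj_fsum_const s _ _ h2).mono fun a b => le_of_eq (by ring)

omit [Fintype Y] in
/-- ★★ **∇_{U,ν}G₀D_U IN BLOCK L² (`Letters313L2MZ.dGDvd ν`)**: the (3.46) line of ∇_{U,ν}G₀∇*_{U,μ} (`Thm33G0L2M.l4m (ν, μ)`, B₂·e^{−δ₁d}) after J_μ,
summed over μ: ‖1_{Δ(y)}∇_{U,ν}G₀D_Uλ‖₂ ≦ B₄·e^{−ρd(y,y′)}‖λ‖₂, any B₄ ≧ |P|·B₂C_Jc, 0 ≦ ρ ≦ δ₁, ρ + σ ≦ δ_J.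
[cite: Balaban1985BackgroundPropagators, (3.46) p.398 + (3.152)–(3.153) p.426 + (3.3) p.390; Balaban1984PropagatorsII, (2.52)–(2.56) pp.232–233 + Lemma 2.1 (2.61) p.234] -/
theorem dGDvd_l2_of_l4m (hG : GeoOK g) {σ c : ℝ} (hrow : RowSum (toB6 g R₀ H₀) σ c)
    {blkW : W → g.Site} {blk : X → g.Site} {G0 : Module.End ℝ (X → ℝ)} {Dds : P → Module.End ℝ (X → ℝ)} {Ddν : Module.End ℝ (X → ℝ)}
    {J : P → (W → ℝ) →ₗ[ℝ] (X → ℝ)} {Dv : (W → ℝ) →ₗ[ℝ] (X → ℝ)} {B₂ δ₁ CJ δJ B₄ ρ : ℝ}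
    (hB₂ : 0 ≤ B₂) (hCJ : 0 ≤ CJ) (hρ : 0 ≤ ρ) (hρ₁ : ρ ≤ δ₁) (hρJ : ρ + σ ≤ δJ)
    (hB₄ : (Fintype.card P : ℝ) * (B₂ * CJ * c) ≤ B₄)
    (hDv : Dv = ∑ μ, Dds μ ∘ₗ J μ)
    (hl4m : ∀ μ, BlockBd (g := toB6 g R₀ H₀) blk blk (Ddν ∘ₗ (G0 ∘ₗ Dds μ)) (fun (y y' : g.Site) => B₂ * Real.exp (-(δ₁ * g.dist y y'))))
    (hJL2 : ∀ μ, BlockBd (g := toB6 g R₀ H₀) blkW blk (J μ) (fun (y y' : g.Site) => CJ * Real.exp (-(δJ * g.dist y y')))) :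
    BlockBd (g := toB6 g R₀ H₀) blkW blk (Ddν ∘ₗ G0 ∘ₗ Dv) (fun (y y' : g.Site) => B₄ * Real.exp (-(ρ * g.dist y y'))) := by
  have heq : Ddν ∘ₗ G0 ∘ₗ Dv = ∑ μ, (Ddν ∘ₗ (G0 ∘ₗ Dds μ)) ∘ₗ J μ := by
    rw [← LinearMap.comp_assoc, comp_dv_eq_fsum hDv (Ddν ∘ₗ G0)]
    rfl
  rw [heq, blockBd_iff_hasMaj]
  refine (hasMaj_l2_fsum_comp hG hrow Finset.univ hB₂ hCJ hρ hρ₁ hρJ (fun μ _ => hl4m μ) (fun μ _ => hJL2 μ)).mono fun a b => ?_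
  rw [Finset.card_univ]
  exact mul_le_mul_of_nonneg_right hB₄ (Real.exp_nonneg _)

/-- ★★ **∇_UG₀D_U IN BLOCK L² (`Letters313L2PZ.dGDv`)** with the slice-diagonal ∇_U of the letters written as Σ_ν Π_ν∘∇_{U,ν} (`hD`; Π_ν the
direction-slice projector, block bound C_Π·e^{−δ_Πd}, `hPr`): ∇_UG₀D_U = Σ_{ν,μ} Π_ν∘(∇_{U,ν}G₀∇*_{U,μ})∘J_μ, so the (3.46) line of ∇_{U,ν}G₀∇*_{U,μ}
(`Thm33G0L2M.l4m`) gives ‖1_{Δ(y)}∇_UG₀D_Uλ‖₂ ≦ B₄·e^{−ρd}‖λ‖₂ for any B₄ ≧ |P|²·C_ΠB₂C_Jc², 0 ≦ ρ ≦ δ₁, ρ + σ ≦ min(δ_J, δ_Π) (two row sums, one per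
kinematic letter). [cite: Balaban1985BackgroundPropagators, (3.46) p.398 + (3.152)–(3.153) p.426 + (3.3) p.390; Balaban1984PropagatorsII, (2.52)–(2.56) pp.232–233 + Lemma 2.1 (2.61) p.234] -/
theorem dGDv_l2_of_l4m (hG : GeoOK g) {σ c : ℝ} (hrow : RowSum (toB6 g R₀ H₀) σ c)
    {blkW : W → g.Site} {blk : X → g.Site} {blkY : Y → g.Site} {G0 : Module.End ℝ (X → ℝ)} {Dd Dds : P → Module.End ℝ (X → ℝ)}
    {Pr : P → (X → ℝ) →ₗ[ℝ] (Y → ℝ)} {D : (X → ℝ) →ₗ[ℝ] (Y → ℝ)} {J : P → (W → ℝ) →ₗ[ℝ] (X → ℝ)} {Dv : (W → ℝ) →ₗ[ℝ] (X → ℝ)}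
    {B₂ δ₁ CJ δJ Cpr δpr B₄ ρ : ℝ}
    (hB₂ : 0 ≤ B₂) (hCJ : 0 ≤ CJ) (hCpr : 0 ≤ Cpr) (hc : 0 ≤ c) (hρ : 0 ≤ ρ) (hρ₁ : ρ ≤ δ₁) (hρJ : ρ + σ ≤ δJ) (hρpr : ρ + σ ≤ δpr)
    (hB₄ : (Fintype.card P : ℝ) ^ 2 * (Cpr * (B₂ * CJ * c) * c) ≤ B₄)
    (hDv : Dv = ∑ μ, Dds μ ∘ₗ J μ) (hD : D = ∑ ν, Pr ν ∘ₗ Dd ν)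
    (hl4m : ∀ ν μ, BlockBd (g := toB6 g R₀ H₀) blk blk (Dd ν ∘ₗ (G0 ∘ₗ Dds μ)) (fun (y y' : g.Site) => B₂ * Real.exp (-(δ₁ * g.dist y y'))))
    (hJL2 : ∀ μ, BlockBd (g := toB6 g R₀ H₀) blkW blk (J μ) (fun (y y' : g.Site) => CJ * Real.exp (-(δJ * g.dist y y'))))
    (hPr : ∀ ν, BlockBd (g := toB6 g R₀ H₀) blk blkY (Pr ν) (fun (y y' : g.Site) => Cpr * Real.exp (-(δpr * g.dist y y')))) :
    BlockBd (g := toB6 g R₀ H₀) blkW blkY (D ∘ₗ G0 ∘ₗ Dv) (fun (y y' : g.Site) => B₄ * Real.exp (-(ρ * g.dist y y'))) := by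
  have htri : Triangle254 (toB6 g R₀ H₀) := fun a b c => hG.tri a b c
  -- the rewriting ∇_UG₀D_U = Σ_ν Π_ν ∘ (∇_{U,ν}G₀D_U)
  have heq : D ∘ₗ G0 ∘ₗ Dv = ∑ ν, Pr ν ∘ₗ (Dd ν ∘ₗ G0 ∘ₗ Dv) := by
    rw [hD, fsum_comp]
    rfl
  -- each ∇_{U,ν}G₀D_U in the unweighted block-L² spaces
  have hin : ∀ ν, HasMaj (l2w (toB6 g R₀ H₀) blkW (fun _ => 1) (fun _ => zero_le_one))
      (l2w (toB6 g R₀ H₀) blk (fun _ => 1) (fun _ => zero_le_one)) (Dd ν ∘ₗ G0 ∘ₗ Dv)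
      (fun a b => (Fintype.card P : ℝ) * (B₂ * CJ * c) * Real.exp (-(ρ * g.dist a b))) := fun ν =>
    (blockBd_iff_hasMaj _ _ _ _).mp (dGDvd_l2_of_l4m hG hrow hB₂ hCJ hρ hρ₁ hρJ le_rfl hDv (hl4m ν) hJL2)
  have hK : 0 ≤ (Fintype.card P : ℝ) * (B₂ * CJ * c) :=
    mul_nonneg (Nat.cast_nonneg _) (mul_nonneg (mul_nonneg hB₂ hCJ) hc)
  -- Π_ν on the left, its own row sum
  have h2 : ∀ ν ∈ (Finset.univ : Finset P), HasMaj (l2w (toB6 g R₀ H₀) blkW (fun _ => 1) (fun _ => zero_le_one))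
      (l2w (toB6 g R₀ H₀) blkY (fun _ => 1) (fun _ => zero_le_one)) (Pr ν ∘ₗ (Dd ν ∘ₗ G0 ∘ₗ Dv))
      (fun a b => Cpr * ((Fintype.card P : ℝ) * (B₂ * CJ * c)) * c * Real.exp (-(ρ * g.dist a b))) := by
    intro ν _
    refine (hasMaj_comp_exp htri hG.dnn hrow hCpr hK hρ le_rfl hρpr ((blockBd_iff_hasMaj _ _ _ _).mp (hPr ν)) (hin ν)).mono
      fun a b => le_of_eq ?_
    simp only [l2w_κ, toB6_dist]
    ring
  rw [heq, blockBd_iff_hasMaj]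
  refine (hasMaj_fsum_const _ _ _ h2).mono fun a b => ?_
  rw [Finset.card_univ]
  calc (Fintype.card P : ℝ) * (Cpr * ((Fintype.card P : ℝ) * (B₂ * CJ * c)) * c * Real.exp (-(ρ * g.dist a b)))
      = (Fintype.card P : ℝ) ^ 2 * (Cpr * (B₂ * CJ * c) * c) * Real.exp (-(ρ * g.dist a b)) := by ring
    _ ≤ B₄ * Real.exp (-(ρ * g.dist a b)) := mul_le_mul_of_nonneg_right hB₄ (Real.exp_nonneg _)

/-! ## §3 The Hölder-probe letter with a sup source: Φ^X_β∘G₀∘D_U (appended v1.1) -/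

omit [Fintype Y] in
/-- ★★ **Φ^X_β∘G₀∘D_U : 𝔠_W⁽⁰⁾ → 𝔠_P^{(β−1)} (`Letters313HZ.pXDv`) FROM THE DIRECTIONAL RIGHT PROBE MEMBER AND THE KINEMATIC LETTER J**: if each
Φ^X_β∘(G₀∇*_{U,μ}) has the (3.43)-shape two-space majorant `B_h·(Lʲη)^{1−β}·e^{−δ₀d}` from the bond blocks to the probe blocks (`h43Rd` — the direction-letter
twin of `Thm33G0Dir.h43R`, a slice relabelling of it at the pins), then after `J_μ : 𝔠_W⁽⁰⁾ → 𝔠⁽⁰⁾` (`hJ`) and the sum over μ: `B_x ≥ |P|·B_h·C_J·c`, `0 ≤ δ₃ ≤ δ₀`,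
`δ₃ + σ ≤ δ_J`. [cite: Balaban1985BackgroundPropagators, (3.43) p.398 + (3.40) p.397 + (3.133) p.422 + (3.3) p.390; Balaban1984PropagatorsII, (2.52)–(2.56) pp.232–233 + Lemma 2.1 (2.61) p.234] -/
theorem pXDv_of_h43Rd (hG : GeoOK g) {σ c : ℝ} (hrow : RowSum (toB6 g R₀ H₀) σ c) {PX : Type} [Fintype PX]
    {blkW : W → g.Site} {blk : X → g.Site} {blkPX : PX → g.Site} {G0 : Module.End ℝ (X → ℝ)} {Dds : P → Module.End ℝ (X → ℝ)}
    {Φ : (X → ℝ) →ₗ[ℝ] (PX → ℝ)} {J : P → (W → ℝ) →ₗ[ℝ] (X → ℝ)} {Dv : (W → ℝ) →ₗ[ℝ] (X → ℝ)} {β Bh δ₀ CJ δJ Bx δ₃ : ℝ}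
    (hBh : 0 ≤ Bh) (hCJ : 0 ≤ CJ) (hδ₃ : 0 ≤ δ₃) (hδ₃0 : δ₃ ≤ δ₀) (hδ₃J : δ₃ + σ ≤ δJ)
    (hBx : (Fintype.card P : ℝ) * (Bh * CJ * c) ≤ Bx)
    (hDv : Dv = ∑ μ, Dds μ ∘ₗ J μ)
    (h43Rd : ∀ μ, HasMajorantHom (g := toB6 g R₀ H₀) blk blkPX (Φ ∘ₗ (G0 ∘ₗ Dds μ))
      (fun (a b : g.Site) => Bh * g.len a ^ (1 - β) * Real.exp (-(δ₀ * g.dist a b))))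
    (hJ : ∀ μ, HasMaj (cNorm R₀ H₀ blkW hG.lenle 0) (cNorm R₀ H₀ blk hG.lenle 0) (J μ)
      (fun a b => CJ * Real.exp (-(δJ * g.dist a b)))) :
    HasMaj (cNormR R₀ H₀ blkW hG.lenle 0) (cNormR R₀ H₀ blkPX hG.lenle (β - 1)) ((Φ ∘ₗ G0) ∘ₗ Dv)
      (fun a b => Bx * Real.exp (-(δ₃ * g.dist a b))) := by
  have htri : Triangle254 (toB6 g R₀ H₀) := fun a b c => hG.tri a b c
  have hsym : DistSymm (toB6 g R₀ H₀) := fun a b => hG.symm a b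
  -- each Φ∘(G₀∇*_{U,μ}) : 𝔠⁽⁰⁾ → 𝔠_P^{(β−1)}
  have h1 : ∀ μ, HasMaj (cNormR R₀ H₀ blk hG.lenle 0) (cNormR R₀ H₀ blkPX hG.lenle (β - 1)) (Φ ∘ₗ (G0 ∘ₗ Dds μ))
      (fun a b => Bh * Real.exp (-(δ₀ * g.dist a b))) := by
    intro μ
    have h := hasMaj_cls_of_hom hG (1 - β) hBh (h43Rd μ)
    rwa [neg_sub] at h
  -- J_μ read between the real-weight classes
  have hJ' : ∀ μ, HasMaj (cNormR R₀ H₀ blkW hG.lenle 0) (cNormR R₀ H₀ blk hG.lenle 0) (J μ)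
      (fun a b => CJ * Real.exp (-(δJ * g.dist a b))) := by
    intro μ
    have h := hasMaj_toR hG (hJ μ)
    simpa only [Nat.cast_zero, neg_zero] using h
  have h2 : ∀ μ ∈ (Finset.univ : Finset P), HasMaj (cNormR R₀ H₀ blkW hG.lenle 0) (cNormR R₀ H₀ blkPX hG.lenle (β - 1))
      ((Φ ∘ₗ (G0 ∘ₗ Dds μ)) ∘ₗ J μ) (fun a b => Bh * CJ * c * Real.exp (-(δ₃ * g.dist a b))) := by
    intro μ _
    refine (hasMaj_comp_exp_mirror hsym htri hG.dnn hrow hBh hCJ hδ₃ hδ₃0 hδ₃J (h1 μ) (hJ' μ)).mono fun a b => le_of_eq ?_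
    simp only [cNormR_κ, toB6_dist]
    ring
  have heq : (Φ ∘ₗ G0) ∘ₗ Dv = ∑ μ, (Φ ∘ₗ (G0 ∘ₗ Dds μ)) ∘ₗ J μ := by
    rw [comp_dv_eq_fsum hDv (Φ ∘ₗ G0)]
    rfl
  rw [heq]
  refine (hasMaj_fsum_const _ _ _ h2).mono fun a b => ?_
  rw [Finset.card_univ]
  calc (Fintype.card P : ℝ) * (Bh * CJ * c * Real.exp (-(δ₃ * g.dist a b)))
      = (Fintype.card P : ℝ) * (Bh * CJ * c) * Real.exp (-(δ₃ * g.dist a b)) := by ring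
    _ ≤ Bx * Real.exp (-(δ₃ * g.dist a b)) := mul_le_mul_of_nonneg_right hBx (Real.exp_nonneg _)

end

end Literature.MathematicalPhysics.QuantumFieldTheory.Balaban1983to89.B9Thm313WholeDvFromDds
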